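import Summits.Schanuel.Schanuel.Theorems.RootDecomp1KHyper30

/-!
# RootDecomp1KHyper — lens 6, generation 15 ADDENDUM «EXP-LATTICE-ANCHORED CELL» (ExpAnchorT.lean v2 88910796…, 2341 l) — continuation (RootDecomp1KHyper31): §5 the family `latTriple w₁ w₂ y`: `ne_ratCombo_of_hyperLatApprox`, `linearIndependent_of_hyperLatApprox`, anchors, `latLB_one_cexp` / `latLB_cexp_cexp`, `sb_three_latTriple_*`, literal cells `sb_three_one_cexp_any` / `sb_three_cexp_cexp_any`

(lens-6 g15-addendum `ExpAnchorT.lean` v2, sha256 88910796…cc8b, farm rc 0 · 0 sorry · axioms std; port by census-1 gen 14 in eight parts RootDecomp1KHyper28–35, cuts of CENSUS-REQUEST STATUS L1561 re-balanced for the 400-line cap,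
critic PORT GO L1568 (e) / ACK L1571; import `RootDecomp1KHyper26`, the source's verbatim g15 plane-lemma copy dropped (exported by Hyper26 in `…HyperCell`), sub-namespace `…HyperCell.LatCell` kept; statements and proofs verbatim
(55 docstrings added, seven generic one-liners privatised with per-part private copies); `hLW : LWMeasure` (tree-proved named fact) stays a binder; `--supports stmt-Schanuel-33363` (residual of record n = 3 := UnanchoredResidual₃′). Nothing here proves Schanuel; rung 0.)
-/

noncomputable section

open Complex IntermediateField Polynomial

namespace Summit.Schanuel.Schanuel.Theorems.RootDecomp1KHyper

namespace HyperCell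

namespace LatCell

variable {n : ℕ}
open Summit.Schanuel.Schanuel.Theorems.RootDecomp1KGeneric (HasHLPairInSpan Rank3SpanResidual
  mem_adjoin_of_mem_span cexp_mem_adjoin_of_mem_span)

/-- `exp(−x) ≤ 1/x` for `x > 0`. -/
private theorem exp_neg_le_one_div' {x : ℝ} (hx : 0 < x) : Real.exp (-x) ≤ 1 / x := by
  rw [Real.exp_neg, ← one_div]
  exact one_div_le_one_div_of_le hx (by linarith [Real.add_one_le_exp x])

/-! ## §5  The X-cell as a family: the triples `(w₁, w₂, y)`, `y` hyper-approximable from `ℤ w₁ + ℤ w₂` -/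

/-- `(r : ℂ) · den r = num r`. -/
private theorem ratCast_mul_den_C (q : ℚ) : (q : ℂ) * (q.den : ℂ) = (q.num : ℂ) := by
  exact_mod_cast Rat.mul_den_eq_num q

/-- **A number hyper-approximable from the lattice is NOT in its ℚ-span** (`LatLB` = Liouville's
inequality for the lattice). -/
theorem ne_ratCombo_of_hyperLatApprox {w₁ w₂ y : ℂ} (hLB : LatLB w₁ w₂)
    (hy : HyperLatApprox w₁ w₂ y) (r₀ r₁ : ℚ) : y ≠ (r₀ : ℂ) * w₁ + (r₁ : ℂ) * w₂ := by
  intro hyeq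
  obtain ⟨C₀, τ, hC₀, hall⟩ := hLB
  have hd₀ : (0 : ℝ) < r₀.den := by exact_mod_cast r₀.den_pos
  have hd₁ : (0 : ℝ) < r₁.den := by exact_mod_cast r₁.den_pos
  set Dd : ℕ := r₀.den * r₁.den with hDd
  have hDpos : 0 < Dd := Nat.mul_pos r₀.den_pos r₁.den_pos
  have hDR : (0 : ℝ) < Dd := by exact_mod_cast hDpos
  have hD1 : (1 : ℝ) ≤ Dd := by exact_mod_cast hDpos
  set κ : ℝ := 1 + |(r₀.num : ℝ)| * r₁.den + |(r₁.num : ℝ)| * r₀.den + 2 * (Dd : ℝ) with hκ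
  have hκ1 : 1 ≤ κ := by
    have : 0 ≤ |(r₀.num : ℝ)| * r₁.den + |(r₁.num : ℝ)| * r₀.den + 2 * (Dd : ℝ) := by positivity
    rw [hκ]; linarith only [this]
  have hκ0 : 0 ≤ κ := by linarith only [hκ1]
  set κ₁ : ℝ := C₀ * κ ^ τ * Dd with hκ₁
  obtain ⟨T, hT⟩ := exists_le_two_pow κ₁
  obtain ⟨A, B, E, hE, hne, hlt⟩ := hy (T + τ + 1)
  have hE1 : (1 : ℝ) ≤ E := by exact_mod_cast hE
  have hEpos : (0 : ℝ) < E := by exact_mod_cast hE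
  have hEC : (E : ℂ) ≠ 0 := by exact_mod_cast hE.ne'
  set Xr : ℝ := 1 + (E : ℝ) + |(A : ℝ)| + |(B : ℝ)| with hXdef
  have hX2 : 2 ≤ Xr := by
    rw [hXdef]; linarith only [hE1, abs_nonneg (A : ℝ), abs_nonneg (B : ℝ)]
  have hX1 : 1 ≤ Xr := by linarith only [hX2]
  have hX0 : 0 < Xr := by linarith only [hX2]
  have hEX : (E : ℝ) ≤ Xr := by
    rw [hXdef]; linarith only [abs_nonneg (A : ℝ), abs_nonneg (B : ℝ)]
  have hAX : |(A : ℝ)| ≤ Xr := by rw [hXdef]; linarith only [hEpos, abs_nonneg (B : ℝ)]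
  have hBX : |(B : ℝ)| ≤ Xr := by rw [hXdef]; linarith only [hEpos, abs_nonneg (A : ℝ)]
  set β : ℂ := ((A : ℂ) * w₁ + (B : ℂ) * w₂) / (E : ℂ) with hβ
  set U : ℤ := (E : ℤ) * r₀.num * r₁.den - A * Dd with hU
  set V : ℤ := (E : ℤ) * r₁.num * r₀.den - B * Dd with hV
  have h0 := ratCast_mul_den_C r₀
  have h1 := ratCast_mul_den_C r₁
  have hEβ : (E : ℂ) * β = (A : ℂ) * w₁ + (B : ℂ) * w₂ := by rw [hβ]; field_simp
  have hUV : (U : ℂ) * w₁ + (V : ℂ) * w₂ = ((Dd : ℕ) : ℂ) * (E : ℂ) * (y - β) := by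
    rw [hU, hV, hDd, hyeq]
    push_cast
    linear_combination -((E : ℂ) * (r₁.den : ℂ) * w₁ * h0) - (E : ℂ) * (r₀.den : ℂ) * w₂ * h1 +
      ((r₀.den : ℂ) * (r₁.den : ℂ)) * hEβ
  have hUV0 : U ≠ 0 ∨ V ≠ 0 := by
    by_contra hn
    push Not at hn
    obtain ⟨hU0, hV0⟩ := hn
    have h2 : ((Dd : ℕ) : ℂ) * (E : ℂ) * (y - β) = 0 := by rw [← hUV, hU0, hV0]; simp
    have hDC : ((Dd : ℕ) : ℂ) ≠ 0 := by exact_mod_cast hDpos.ne'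
    rcases mul_eq_zero.mp h2 with h3 | h3
    · rcases mul_eq_zero.mp h3 with h4 | h4
      · exact hDC h4
      · exact hEC h4
    · exact hne (sub_eq_zero.mp h3)
  have hnorm : ‖(U : ℂ) * w₁ + (V : ℂ) * w₂‖ = (Dd : ℝ) * (E : ℝ) * ‖y - β‖ := by
    rw [hUV, norm_mul, norm_mul, Complex.norm_natCast, Complex.norm_natCast]
  -- height
  have hheight : 1 + |(U : ℝ)| + |(V : ℝ)| ≤ κ * Xr := by
    have hUle : |(U : ℝ)| ≤ Xr * (|(r₀.num : ℝ)| * r₁.den) + Xr * Dd := by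
      rw [hU]; push_cast
      calc |(E : ℝ) * (r₀.num : ℝ) * (r₁.den : ℝ) - (A : ℝ) * (Dd : ℝ)|
          ≤ |(E : ℝ) * (r₀.num : ℝ) * (r₁.den : ℝ)| + |(A : ℝ) * (Dd : ℝ)| := abs_sub _ _
        _ = (E : ℝ) * (|(r₀.num : ℝ)| * r₁.den) + |(A : ℝ)| * Dd := by
            rw [abs_mul, abs_mul, abs_mul, abs_of_pos hEpos, Nat.abs_cast, Nat.abs_cast]; ring
        _ ≤ Xr * (|(r₀.num : ℝ)| * r₁.den) + Xr * Dd := by gcongr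
    have hVle : |(V : ℝ)| ≤ Xr * (|(r₁.num : ℝ)| * r₀.den) + Xr * Dd := by
      rw [hV]; push_cast
      calc |(E : ℝ) * (r₁.num : ℝ) * (r₀.den : ℝ) - (B : ℝ) * (Dd : ℝ)|
          ≤ |(E : ℝ) * (r₁.num : ℝ) * (r₀.den : ℝ)| + |(B : ℝ) * (Dd : ℝ)| := abs_sub _ _
        _ = (E : ℝ) * (|(r₁.num : ℝ)| * r₀.den) + |(B : ℝ)| * Dd := by
            rw [abs_mul, abs_mul, abs_mul, abs_of_pos hEpos, Nat.abs_cast, Nat.abs_cast]; ring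
        _ ≤ Xr * (|(r₁.num : ℝ)| * r₀.den) + Xr * Dd := by gcongr
    calc 1 + |(U : ℝ)| + |(V : ℝ)| ≤ Xr + (Xr * (|(r₀.num : ℝ)| * r₁.den) + Xr * Dd) +
          (Xr * (|(r₁.num : ℝ)| * r₀.den) + Xr * Dd) := by linarith only [hUle, hVle, hX1]
      _ = κ * Xr := by rw [hκ]; ring
  have hh0 : 0 ≤ 1 + |(U : ℝ)| + |(V : ℝ)| := by positivity
  have hpowle : (1 + |(U : ℝ)| + |(V : ℝ)|) ^ τ ≤ κ ^ τ * Xr ^ τ := by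
    rw [← mul_pow]; exact pow_le_pow_left₀ hh0 hheight τ
  -- the clash
  have hlow := hall U V hUV0
  rw [hnorm] at hlow
  have hXp : 0 < Xr ^ (T + τ + 1) := by positivity
  have hexp : Real.exp (-(Xr ^ (T + τ + 1))) ≤ 1 / Xr ^ (T + τ + 1) := exp_neg_le_one_div' hXp
  have hdist : ‖y - β‖ < 1 / Xr ^ (T + τ + 1) := hlt.trans_le hexp
  have hpos : 0 < C₀ * (κ ^ τ * Xr ^ τ) * ((Dd : ℝ) * Xr) := by positivity
  have h2 : (1 : ℝ) < κ₁ / Xr ^ T := by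
    calc (1 : ℝ) ≤ C₀ * (1 + |(U : ℝ)| + |(V : ℝ)|) ^ τ * ((Dd : ℝ) * (E : ℝ) * ‖y - β‖) := hlow
      _ ≤ C₀ * (κ ^ τ * Xr ^ τ) * ((Dd : ℝ) * Xr * ‖y - β‖) := by gcongr
      _ = C₀ * (κ ^ τ * Xr ^ τ) * ((Dd : ℝ) * Xr) * ‖y - β‖ := by ring
      _ < C₀ * (κ ^ τ * Xr ^ τ) * ((Dd : ℝ) * Xr) * (1 / Xr ^ (T + τ + 1)) :=
          mul_lt_mul_of_pos_left hdist hpos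
      _ = κ₁ / Xr ^ T := by rw [hκ₁, pow_add, pow_add, pow_one]; field_simp
  have h3 : Xr ^ T < κ₁ := by
    have hXT : 0 < Xr ^ T := by positivity
    rw [lt_div_iff₀ hXT, one_mul] at h2
    exact h2
  have h4 : κ₁ ≤ Xr ^ T := hT.trans (pow_le_pow_left₀ (by norm_num) hX2 T)
  linarith only [h3, h4]

/-- **`LatLB w₁ w₂ ∧ HyperLatApprox w₁ w₂ y` ⇒ `w₁, w₂, y` are ℚ-linearly independent.** -/
theorem linearIndependent_of_hyperLatApprox {w₁ w₂ y : ℂ} (hLB : LatLB w₁ w₂)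
    (hy : HyperLatApprox w₁ w₂ y) : LinearIndependent ℚ (![w₁, w₂, y] : Fin 3 → ℂ) := by
  rw [Fintype.linearIndependent_iff]
  intro g hg
  rw [Fin.sum_univ_three] at hg
  simp only [Matrix.cons_val_zero, Matrix.cons_val_one, Matrix.cons_val_two, Matrix.head_cons,
    Matrix.tail_cons] at hg
  have hg' : ((g 0 : ℚ) : ℂ) * w₁ + ((g 1 : ℚ) : ℂ) * w₂ + ((g 2 : ℚ) : ℂ) * y = 0 := by
    simpa [Rat.smul_def, smul_eq_mul] using hg
  by_cases hg2 : g 2 = 0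
  · -- a rational relation between w₁, w₂: clear denominators and use LatLB
    have h01 : ((g 0 : ℚ) : ℂ) * w₁ + ((g 1 : ℚ) : ℂ) * w₂ = 0 := by
      rw [hg2] at hg'; simpa using hg'
    have h0 := ratCast_mul_den_C (g 0)
    have h1 := ratCast_mul_den_C (g 1)
    have hrel : (((g 0).num * (g 1).den : ℤ) : ℂ) * w₁ + (((g 1).num * (g 0).den : ℤ) : ℂ) * w₂ = 0 := by
      push_cast
      linear_combination -(((g 1).den : ℂ) * w₁ * h0) - ((g 0).den : ℂ) * w₂ * h1 +
        (((g 0).den : ℂ) * ((g 1).den : ℂ)) * h01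
    have hg0 : g 0 = 0 := by
      by_contra hne0
      have : (g 0).num * ((g 1).den : ℤ) ≠ 0 :=
        mul_ne_zero (Rat.num_ne_zero.mpr hne0) (by exact_mod_cast (g 1).den_pos.ne')
      exact hLB.ne_zero (Or.inl this) hrel
    have hg1 : g 1 = 0 := by
      by_contra hne1
      have : (g 1).num * ((g 0).den : ℤ) ≠ 0 :=
        mul_ne_zero (Rat.num_ne_zero.mpr hne1) (by exact_mod_cast (g 0).den_pos.ne')
      exact hLB.ne_zero (Or.inr this) hrel
    intro i
    match i with
    | 0 => exact hg0
    | 1 => exact hg1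
    | 2 => exact hg2
  · exfalso
    have hg2C : ((g 2 : ℚ) : ℂ) ≠ 0 := by exact_mod_cast hg2
    apply ne_ratCombo_of_hyperLatApprox hLB hy (-(g 0) / g 2) (-(g 1) / g 2)
    push_cast
    field_simp
    linear_combination hg'

/-- The triple `(w₁, w₂, y)`. -/
def latTriple (w₁ w₂ y : ℂ) : Fin 3 → ℂ := ![w₁, w₂, y]

/-- Coordinate `0` of `latTriple w₁ w₂ y = (w₁, w₂, y)`. -/
@[simp] theorem latTriple_zero (w₁ w₂ y : ℂ) : latTriple w₁ w₂ y 0 = w₁ := rfl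
/-- Coordinate `1` of `latTriple w₁ w₂ y = (w₁, w₂, y)`. -/
@[simp] theorem latTriple_one (w₁ w₂ y : ℂ) : latTriple w₁ w₂ y 1 = w₂ := rfl
/-- Coordinate `2` of `latTriple w₁ w₂ y = (w₁, w₂, y)`. -/
@[simp] theorem latTriple_two (w₁ w₂ y : ℂ) : latTriple w₁ w₂ y 2 = y := rfl

/-- The integer form with coefficients `(−A, −B, E)` on `(w₁, w₂, y)` is `E·y − (A w₁ + B w₂)`. -/
private theorem latTriple_form (w₁ w₂ y : ℂ) (A B : ℤ) (E : ℕ) :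
    ∑ i, ((![-A, -B, (E : ℤ)] : Fin 3 → ℤ) i : ℂ) * latTriple w₁ w₂ y i =
      (E : ℂ) * y - ((A : ℂ) * w₁ + (B : ℂ) * w₂) := by
  rw [Fin.sum_univ_three]
  simp only [latTriple_zero, latTriple_one, latTriple_two, Matrix.cons_val_zero,
    Matrix.cons_val_one, Matrix.head_cons, Matrix.cons_val_two, Matrix.tail_cons]
  push_cast
  ring

/-- The height `Σ i, |h i|` of the coefficient vector `(−A, −B, E)` is `|A| + |B| + E`. -/
private theorem latTriple_hsum (A B : ℤ) (E : ℕ) :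
    ∑ i, |(((![-A, -B, (E : ℤ)] : Fin 3 → ℤ) i : ℤ) : ℝ)| = |(A : ℝ)| + |(B : ℝ)| + E := by
  rw [Fin.sum_univ_three]
  simp only [Matrix.cons_val_zero, Matrix.cons_val_one, Matrix.head_cons, Matrix.cons_val_two,
    Matrix.tail_cons, Int.cast_neg, abs_neg, Int.cast_natCast, Nat.abs_cast]

/-- `q · exp(−X^(m+1)) ≤ exp(−X^m)` for `0 < q ≤ X`, `1 ≤ X`. -/
private theorem mul_exp_neg_pow_succ_le {q X : ℝ} (hq : 0 < q) (hqX : q ≤ X) (hX : 1 ≤ X)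
    (m : ℕ) : q * Real.exp (-(X ^ (m + 1))) ≤ Real.exp (-(X ^ m)) := by
  have hlog : Real.log q ≤ X ^ (m + 1) - X ^ m :=
    calc Real.log q ≤ q - 1 := Real.log_le_sub_one_of_pos hq
      _ ≤ X - 1 := by linarith
      _ ≤ X ^ m * (X - 1) := le_mul_of_one_le_left (by linarith) (one_le_pow₀ hX)
      _ = X ^ (m + 1) - X ^ m := by ring
  rw [← Real.exp_log hq, ← Real.exp_add]
  exact Real.exp_le_exp.mpr (by linarith)

/-- **`HyperLatApprox w₁ w₂ y` ⇒ `(w₁, w₂, y)` is `HyperLinLiouville`** (the approximants ARE small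
forms: `h = (−A, −B, E)`). -/
theorem hyperLinLiouville_latTriple {w₁ w₂ y : ℂ} (hy : HyperLatApprox w₁ w₂ y) :
    HyperLinLiouville (latTriple w₁ w₂ y) := by
  intro m
  obtain ⟨A, B, E, hE, hne, hlt⟩ := hy (m + 1)
  refine ⟨![-A, -B, (E : ℤ)], ?_, ?_⟩
  · intro h0
    have := congr_fun h0 2
    simp only [Matrix.cons_val_two, Matrix.tail_cons, Matrix.head_cons, Pi.zero_apply,
      Nat.cast_eq_zero] at this
    omega
  · rw [latTriple_form, latTriple_hsum]
    have hE0 : (0 : ℝ) < E := by exact_mod_cast hE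
    have hEC : (E : ℂ) ≠ 0 := by exact_mod_cast hE.ne'
    set X : ℝ := 1 + (E : ℝ) + |(A : ℝ)| + |(B : ℝ)| with hX
    have hX1 : 1 ≤ X := by
      rw [hX]; linarith only [hE0, abs_nonneg (A : ℝ), abs_nonneg (B : ℝ)]
    have hEX : (E : ℝ) ≤ X := by
      rw [hX]; linarith only [abs_nonneg (A : ℝ), abs_nonneg (B : ℝ)]
    have e : (E : ℂ) * y - ((A : ℂ) * w₁ + (B : ℂ) * w₂) =
        (E : ℂ) * (y - ((A : ℂ) * w₁ + (B : ℂ) * w₂) / (E : ℂ)) := by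
      field_simp
    have eX : 1 + (|(A : ℝ)| + |(B : ℝ)| + E) = X := by rw [hX]; ring
    rw [e, norm_mul, Complex.norm_natCast, eX]
    calc (E : ℝ) * ‖y - ((A : ℂ) * w₁ + (B : ℂ) * w₂) / (E : ℂ)‖ < E * Real.exp (-(X ^ (m + 1))) :=
          mul_lt_mul_of_pos_left hlt hE0
      _ ≤ Real.exp (-(X ^ m)) := mul_exp_neg_pow_succ_le hE0 hEX hX1 m

/-- `(w₁, w₂, y)` is ℚ-free when `LatLB w₁ w₂` and `y` is hyper-approximable from the lattice. -/
theorem linearIndependent_latTriple {w₁ w₂ y : ℂ} (hLB : LatLB w₁ w₂)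
    (hy : HyperLatApprox w₁ w₂ y) : LinearIndependent ℚ (latTriple w₁ w₂ y) :=
  linearIndependent_of_hyperLatApprox hLB hy

/-- `(1, e^{α}, y)` carries the one-exponential X-cell anchor (`N₁ = N₂ = 1`). -/
theorem hasExpIntAnchor_latTriple {α : ℂ} (hα : IsAlgebraic ℚ α) (hirr : ∀ r : ℚ, α ≠ (r : ℂ))
    (y : ℂ) : HasExpIntAnchor (latTriple 1 (cexp α) y) := by
  refine ⟨α, 1, 1, hα, hirr, one_ne_zero, one_ne_zero, ?_, ?_⟩
  · simpa using Submodule.subset_span (R := ℤ) (s := Set.range (latTriple 1 (cexp α) y))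
      ⟨0, rfl⟩
  · simpa using Submodule.subset_span (R := ℤ) (s := Set.range (latTriple 1 (cexp α) y))
      ⟨1, rfl⟩

/-- `(e^{α₁}, e^{α₂}, y)` carries the two-exponential X-cell anchor (`N₁ = N₂ = 1`). -/
theorem hasExpPairAnchor_latTriple {α : Fin 2 → ℂ} (hα : ∀ i, IsAlgebraic ℚ (α i))
    (hli : LinearIndependent ℚ α) (y : ℂ) :
    HasExpPairAnchor (latTriple (cexp (α 0)) (cexp (α 1)) y) := by
  refine ⟨α, 1, 1, hα, hli, one_ne_zero, one_ne_zero, ?_, ?_⟩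
  · simpa using Submodule.subset_span (R := ℤ)
      (s := Set.range (latTriple (cexp (α 0)) (cexp (α 1)) y)) ⟨0, rfl⟩
  · simpa using Submodule.subset_span (R := ℤ)
      (s := Set.range (latTriple (cexp (α 0)) (cexp (α 1)) y)) ⟨1, rfl⟩

/-- **`LatLB 1 e^{α}` for `α ∈ ℚ̄ ∖ ℚ` (mod the LW measure)** — Liouville's inequality for the
lattice `ℤ + ℤ e^{α}`, from Ably's measure at the ℚ-free algebraic pair `(1, α)`. -/
theorem latLB_one_cexp (hLW : LWMeasure) {α : ℂ} (hα : IsAlgebraic ℚ α)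
    (hirr : ∀ r : ℚ, α ≠ (r : ℂ)) : LatLB 1 (cexp α) := by
  set u : Fin 2 → ℂ := ![(1 : ℂ), α] with hu
  have hua : ∀ i, IsAlgebraic ℚ (u i) := by
    intro i
    match i with
    | 0 => simpa [hu] using isAlgebraic_algebraMap (R := ℚ) (A := ℂ) (1 : ℚ)
    | 1 => simpa [hu] using hα
  have hli : LinearIndependent ℚ u := by
    have h := linearIndependent_int_irrat hirr (one_ne_zero (α := ℤ))
    simpa [hu] using h
  have hθ := mvPolyMeasure_exp_of_LW hLW hua hli
  have h := latLB_of_mvPolyMeasure hθ (MvPolynomial.C 1) (MvPolynomial.C 1 * MvPolynomial.X 1)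
    (indep_C_CX one_ne_zero one_ne_zero)
  simpa [hu] using h

/-- **`LatLB e^{α₁} e^{α₂}` for ℚ-free algebraic `α₁, α₂` (mod the LW measure).** -/
theorem latLB_cexp_cexp (hLW : LWMeasure) {α : Fin 2 → ℂ} (hα : ∀ i, IsAlgebraic ℚ (α i))
    (hli : LinearIndependent ℚ α) : LatLB (cexp (α 0)) (cexp (α 1)) := by
  have hθ := mvPolyMeasure_exp_of_LW hLW hα hli
  have h := latLB_of_mvPolyMeasure hθ (MvPolynomial.C 1 * MvPolynomial.X 0)
    (MvPolynomial.C 1 * MvPolynomial.X 1) (indep_CX_CX one_ne_zero one_ne_zero)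
  simpa using h

/-- **THE ONE-EXPONENTIAL X-CELL AS A FAMILY (mod the LW measure).**  For `α ∈ ℚ̄ ∖ ℚ` and `y`
hyper-approximable from `ℤ + ℤ e^{α}`, the triple `(1, e^{α}, y)` is ℚ-free, `HyperLinLiouville`,
anchored, and has Schanuel's bound `trdeg ℚ(e^{α}, y, e, e^{e^{α}}, e^{y}) ≥ 3`. -/
theorem sb_three_latTriple_one_cexp (hLW : LWMeasure) {α : ℂ} (hα : IsAlgebraic ℚ α)
    (hirr : ∀ r : ℚ, α ≠ (r : ℂ)) {y : ℂ} (hy : HyperLatApprox 1 (cexp α) y) :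
    LinearIndependent ℚ (latTriple 1 (cexp α) y) ∧ HyperLinLiouville (latTriple 1 (cexp α) y) ∧
      HasExpIntAnchor (latTriple 1 (cexp α) y) ∧ SB 3 (latTriple 1 (cexp α) y) := by
  have hLI := linearIndependent_latTriple (latLB_one_cexp hLW hα hirr) hy
  have hH := hyperLinLiouville_latTriple hy
  have hA := hasExpIntAnchor_latTriple hα hirr y
  exact ⟨hLI, hH, hA, sb_three_of_expIntAnchor hLW hLI hH hA⟩

/-- **THE TWO-EXPONENTIAL X-CELL AS A FAMILY (mod the LW measure).** -/
theorem sb_three_latTriple_cexp_cexp (hLW : LWMeasure) {α : Fin 2 → ℂ}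
    (hα : ∀ i, IsAlgebraic ℚ (α i)) (hli : LinearIndependent ℚ α) {y : ℂ}
    (hy : HyperLatApprox (cexp (α 0)) (cexp (α 1)) y) :
    LinearIndependent ℚ (latTriple (cexp (α 0)) (cexp (α 1)) y) ∧
      HyperLinLiouville (latTriple (cexp (α 0)) (cexp (α 1)) y) ∧
      HasExpPairAnchor (latTriple (cexp (α 0)) (cexp (α 1)) y) ∧
      SB 3 (latTriple (cexp (α 0)) (cexp (α 1)) y) := by
  have hLI := linearIndependent_latTriple (latLB_cexp_cexp hLW hα hli) hy
  have hH := hyperLinLiouville_latTriple hy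
  have hA := hasExpPairAnchor_latTriple hα hli y
  exact ⟨hLI, hH, hA, sb_three_of_expPairAnchor hLW hLI hH hA⟩

/-- **THE LITERAL ℓ2 CELL `(1, e^{α}, y)`, `α ∈ ℚ̄ ∖ ℚ`, ANY `y` (mod the LW measure).**  Every ℚ-free
`HyperLinLiouville` triple of the form `(1, e^{α}, y)` has Schanuel's bound — no hypothesis on `y`
beyond the residual's own (`x = e^{α} ∉ ℚ̄` by Hermite–Lindemann: the critic's "(1, x, y), x ∉ ℚ̄"). -/
theorem sb_three_one_cexp_any (hLW : LWMeasure) {α : ℂ} (hα : IsAlgebraic ℚ α)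
    (hirr : ∀ r : ℚ, α ≠ (r : ℂ)) {y : ℂ} (hz : LinearIndependent ℚ (latTriple 1 (cexp α) y))
    (hH : HyperLinLiouville (latTriple 1 (cexp α) y)) : SB 3 (latTriple 1 (cexp α) y) :=
  sb_three_of_expIntAnchor hLW hz hH (hasExpIntAnchor_latTriple hα hirr y)

/-- The two-exponential form: every ℚ-free `HyperLinLiouville` triple `(e^{α₁}, e^{α₂}, y)` with
`α₁, α₂ ∈ ℚ̄` ℚ-linearly independent has Schanuel's bound (mod the LW measure), ANY `y`. -/
theorem sb_three_cexp_cexp_any (hLW : LWMeasure) {α : Fin 2 → ℂ} (hα : ∀ i, IsAlgebraic ℚ (α i))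
    (hli : LinearIndependent ℚ α) {y : ℂ}
    (hz : LinearIndependent ℚ (latTriple (cexp (α 0)) (cexp (α 1)) y))
    (hH : HyperLinLiouville (latTriple (cexp (α 0)) (cexp (α 1)) y)) :
    SB 3 (latTriple (cexp (α 0)) (cexp (α 1)) y) :=
  sb_three_of_expPairAnchor hLW hz hH (hasExpPairAnchor_latTriple hα hli y)

end LatCell

end HyperCell

end Summit.Schanuel.Schanuel.Theorems.RootDecomp1KHyper
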